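import Mathlib
import HarnessLib
import Literature.Computability.AlgebraicComplexity.HessianRank
import Literature.Computability.AlgebraicComplexity.MignonRessayreBound

/-!
# Crux `RankDefectRepresentations` (stmt-PneNP-18923), line `rank-dehn-ladder`: the CAUCHY COMPRESSION LEMMA (few eigenvalues ⇒ cheap compression)

Companion tool to the Number Operator Lemma (`…NumberOperator`, p610916), negative rung N0 of the line (lead g5).
Let `P_0, …, P_{m−1}` be a complete family of orthogonal idempotent matrices (`P_a² = P_a`, `P_a P_b = 0` for `a ≠ b`,
`∑ P_a = 1`) and `D = ∑ c_a P_a` with DISTINCT scalars `c_a` — a diagonalizable operator with (at most) `m` eigenvalues.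
Then for every matrix `X`, the block-diagonal compression `∑_a P_a X P_a` satisfies

  `rank (X − ∑_a P_a X P_a) ≤ m · rank [D, X]`        (`rank_sub_compression_le`).

Proof: `P_a [D,X] P_b = (c_a − c_b) P_a X P_b`, so the off-diagonal part `∑_a P_a X (1 − P_a)` equals
`∑_a P_a · [D,X] · N_a` with `N_a = ∑_{b ≠ a} (c_a − c_b)⁻¹ P_b` — `m` terms of rank `≤ rank [D,X]` (a block Schur product with the
Cauchy matrix `1/(c_a − c_b)`).  Use on this line: an operator with FEW eigenvalues that almost commutes with `X` forces `X` to be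
cheaply compressible to its eigenspaces — no cut-lemma multiplicity arises for a SINGLE such operator.  With the Number Operator
Lemma (the number operator `E = ∑ ε_i` of an almost-representation is within rank `n³t` of such a `D` with `m = n+1`) this gives
the approximate WEIGHT decomposition at polynomial cost (`Cruxes/RankDefectRepresentations/Lines/rank-dehn-ladder-NOL.md` §2);
for several commuting such operators the masks multiply (`…-SA.md` §6(l)) — that is where the cut lemma enters.
HONEST FRAMING: elementary linear algebra; P ≠ NP is not moved; F-N2 is a FRONTIER formal rung.
-/

set_option linter.dupNamespace false -- `Summit.PneNP.PneNP.…`: summit = sub-problem name (D-0017)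

namespace Summit.PneNP.PneNP.Theorems.CnfIdealGenLengthRankDefectRepresentationsNumberOperatorCompression

open Finset
open Literature.Computability.AlgebraicComplexity (rank_add_le rank_sum_le rank_smul_le)

variable {K : Type*} [Field K] {d m : ℕ}

/-- In a complete orthogonal family, `P_a · D = c_a P_a` for `D = ∑ c_b P_b`. -/
theorem proj_mul_diag (P : Fin m → Matrix (Fin d) (Fin d) K) (hP : ∀ a, P a * P a = P a)
    (horth : ∀ a b, a ≠ b → P a * P b = 0) (c : Fin m → K) (a : Fin m) :
    P a * (∑ b, c b • P b) = c a • P a := by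
  rw [Finset.mul_sum, Finset.sum_eq_single a]
  · rw [mul_smul_comm, hP a]
  · intro b _ hb; rw [mul_smul_comm, horth a b (Ne.symm hb), smul_zero]
  · intro h; exact absurd (Finset.mem_univ a) h

/-- In a complete orthogonal family, `D · P_b = c_b P_b` for `D = ∑ c_a P_a`. -/
theorem diag_mul_proj (P : Fin m → Matrix (Fin d) (Fin d) K) (hP : ∀ a, P a * P a = P a)
    (horth : ∀ a b, a ≠ b → P a * P b = 0) (c : Fin m → K) (b : Fin m) :
    (∑ a, c a • P a) * P b = c b • P b := by
  rw [Finset.sum_mul, Finset.sum_eq_single b]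
  · rw [smul_mul_assoc, hP b]
  · intro a _ ha; rw [smul_mul_assoc, horth a b ha, smul_zero]
  · intro h; exact absurd (Finset.mem_univ b) h

/-- The Sylvester identity blockwise: `P_a [D, X] P_b = (c_a − c_b) · P_a X P_b`. -/
theorem proj_comm_proj (P : Fin m → Matrix (Fin d) (Fin d) K) (hP : ∀ a, P a * P a = P a)
    (horth : ∀ a b, a ≠ b → P a * P b = 0) (c : Fin m → K) (X : Matrix (Fin d) (Fin d) K) (a b : Fin m) :
    P a * ((∑ e, c e • P e) * X - X * ∑ e, c e • P e) * P b = (c a - c b) • (P a * X * P b) := by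
  rw [mul_sub, sub_mul, sub_smul]
  congr 1
  · rw [← mul_assoc, proj_mul_diag P hP horth c a, smul_mul_assoc, smul_mul_assoc]
  · rw [mul_assoc, mul_assoc, diag_mul_proj P hP horth c b, mul_smul_comm, mul_smul_comm, mul_assoc]

/-- **Cauchy compression lemma.** For a complete orthogonal family of idempotents `P_a` (`a : Fin m`) and `D = ∑ c_a P_a` with
distinct `c_a`, every `X` is within rank `m · rank [D, X]` of its block-diagonal compression `∑_a P_a X P_a`. [folklore] -/
theorem rank_sub_compression_le (P : Fin m → Matrix (Fin d) (Fin d) K) (hP : ∀ a, P a * P a = P a)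
    (horth : ∀ a b, a ≠ b → P a * P b = 0) (hsum : ∑ a, P a = 1) (c : Fin m → K) (hc : Function.Injective c)
    (X : Matrix (Fin d) (Fin d) K) :
    (X - ∑ a, P a * X * P a).rank ≤ m * ((∑ a, c a • P a) * X - X * ∑ a, c a • P a).rank := by
  classical
  set C := (∑ a, c a • P a) * X - X * ∑ a, c a • P a with hC
  -- the Cauchy right factors
  let N : Fin m → Matrix (Fin d) (Fin d) K := fun a => ∑ b ∈ univ.erase a, (c a - c b)⁻¹ • P b
  -- each compressed term: P_a C N_a = P_a X (1 - P_a)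
  have hterm : ∀ a, P a * C * N a = P a * X * (1 - P a) := by
    intro a
    have h1 : P a * C * N a = ∑ b ∈ univ.erase a, P a * X * P b := by
      simp only [N, Finset.mul_sum, mul_smul_comm]
      refine Finset.sum_congr rfl fun b hb => ?_
      have hab : a ≠ b := (Finset.mem_erase.1 hb).1.symm
      have hne : c a - c b ≠ 0 := sub_ne_zero.2 fun h => hab (hc h)
      rw [mul_assoc (P a) C (P b), ← mul_assoc, hC, proj_comm_proj P hP horth c X a b, smul_smul,
        inv_mul_cancel₀ hne, one_smul]
    rw [h1, ← Finset.mul_sum, mul_sub, mul_one]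
    have : ∑ b ∈ univ.erase a, P b = 1 - P a := by
      rw [← hsum, ← Finset.add_sum_erase _ _ (Finset.mem_univ a)]; abel
    rw [this, mul_sub, mul_one]
  -- the off-diagonal part as a sum of the compressed terms
  have hoff : X - ∑ a, P a * X * P a = ∑ a, P a * C * N a := by
    simp only [hterm, mul_sub, mul_one, Finset.sum_sub_distrib]
    rw [← Finset.sum_mul, hsum, one_mul]
  rw [hoff]
  calc (∑ a, P a * C * N a).rank ≤ ∑ a, (P a * C * N a).rank := rank_sum_le _ _
    _ ≤ ∑ _a : Fin m, C.rank := Finset.sum_le_sum fun a _ =>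
        (Matrix.rank_mul_le_left _ _).trans (Matrix.rank_mul_le_right _ _)
    _ = m * C.rank := by rw [Finset.sum_const, Finset.card_univ, Fintype.card_fin, smul_eq_mul]

/-- Consequence: if additionally `rank [D, X] ≤ κ`, the compression moves `X` by rank at most `m κ`, and the compression commutes
with every `P_a`. [folklore] -/
theorem compression_commutes (P : Fin m → Matrix (Fin d) (Fin d) K) (hP : ∀ a, P a * P a = P a)
    (horth : ∀ a b, a ≠ b → P a * P b = 0) (X : Matrix (Fin d) (Fin d) K) (b : Fin m) :
    P b * (∑ a, P a * X * P a) = (∑ a, P a * X * P a) * P b := by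
  rw [Finset.mul_sum, Finset.sum_mul, Finset.sum_eq_single b, Finset.sum_eq_single b]
  · rw [← mul_assoc, ← mul_assoc, hP b]
    simp only [Matrix.mul_assoc, hP b]
  · intro a _ ha; rw [mul_assoc, horth a b ha, mul_zero]
  · intro h; exact absurd (Finset.mem_univ b) h
  · intro a _ ha; rw [← mul_assoc, ← mul_assoc, horth b a (Ne.symm ha), zero_mul, zero_mul]
  · intro h; exact absurd (Finset.mem_univ b) h

end Summit.PneNP.PneNP.Theorems.CnfIdealGenLengthRankDefectRepresentationsNumberOperatorCompression
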